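import Literature.Analysis.FunctionSpaces.GuichardetUHF
import HarnessLib

/-!
# The quasi-local (UHF) algebra on the Guichardet space: order, injectivity, adjoint, isotony facts

Companion to `Literature.Analysis.FunctionSpaces.GuichardetUHF` (trunk AnalysisL, item P5; notions
`quasi_local_algebra`, `cstar_state_gns`). That file builds the quasi-local C⋆-algebra
`𝔄 = Literature.QLattice.quasiLocalAlg d q hstar ⊆ B(𝓗)`, `𝓗 = ℓ²(FinSuppConfig d q)` the Guichardet
space, and equips `↥𝔄` with the Loewner order inherited from `B(𝓗)` as a subtype. It leaves as
the named fact `Literature.QLattice.starOrderedRing_quasiLocalAlg : Prop` (`StarOrderedRing ↥𝔄`) the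
statement that this inherited order is the C⋆-order of `𝔄`. This file proves it:
`Literature.Analysis.FunctionSpaces.starOrderedRing_quasiLocalAlg_holds`. It also discharges the named fact
`Literature.Analysis.FunctionSpaces.localRep_injective` (injectivity of the local representations
`π_Λ = localRepCLM Λ : 𝔄_Λ → B(𝓗)`, `A ↦ A ⊗ 𝟙_{Λᶜ}`): `Literature.Analysis.FunctionSpaces.localRep_injective_holds`.
Finally it discharges the standing ⋆-preservation hypothesis `hstar` of that file, the named
fact `Literature.Analysis.FunctionSpaces.localRep_map_star'` (`π_Λ(Aᴴ) = π_Λ(A)⋆` in `B(𝓗)`):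
`Literature.Analysis.FunctionSpaces.localRep_map_star'_holds`. It also discharges the isotony fact
`Literature.Analysis.FunctionSpaces.localRep_compatible` (`π_{Λ'}(A ⊗ 𝟙_{Λ'∖Λ}) = π_Λ(A)` for `Λ ⊆ Λ'`, on the
underlying operators of `B(𝓗)`): `Literature.Analysis.FunctionSpaces.localRep_compatible_holds`, a finite-sum
reindexing over the product basis; `nonempty_quasiLocalAlgebra_of_locality_shift` has `hstar`,
`hsor`, `hinj` and `hcompat` supplied.

## The printed argument

For `S, T ∈ 𝔄`, `S ≤ T` in `B(𝓗)` iff `P = T - S` is positive in `B(𝓗)`, i.e. selfadjoint with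
`σ(P) ⊆ [0, ∞)` (Bratteli–Robinson I, Definition 2.2.8 and Theorem 2.2.12: `P ≥ 0 ⇔ P = B⋆B`).
A positive `P` has a unique positive square root `√P`, and `√P` lies in the abelian
C⋆-subalgebra generated by `P` (Bratteli–Robinson I, Theorem 2.2.10); since `𝔄` is a norm-closed
⋆-subalgebra containing `P`, `√P ∈ 𝔄` and `T = S + (√P)⋆(√P)`. (Equivalently: positivity is a
spectral condition and `σ_𝔄(P) = σ_{B(𝓗)}(P)` by spectral permanence, Bratteli–Robinson I,
Proposition 2.2.7.) Conversely every `R⋆R`, `R ∈ 𝔄`, is Loewner-positive.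

Injectivity of `π_Λ` (the printed assertion that `A ↦ A ⊗ 𝟙_{Λ₂}` identifies
`𝔄_{Λ₁} = 𝓛(𝓗_{Λ₁})` isomorphically with the C⋆-subalgebra `𝔄_{Λ₁} ⊗ 𝟙_{Λ₂}` of
`𝔄_{Λ₁ ∪ Λ₂}`, Bratteli–Robinson I Example 2.6.12, used for quantum spin systems in
Bratteli–Robinson II §6.2.1): the matrix coefficient `A τ' τ₀` is the coordinate of
`π_Λ(A) δ_ρ`, `ρ = (τ₀ inside Λ, 0 outside)`, at the configuration `(τ' inside Λ, 0 outside)`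
(`localRepCLM_single_splice`), so `π_Λ(A) = π_Λ(B)` forces `A = B` entrywise.

⋆-preservation of `π_Λ` (the same printed assertion: `A ↦ A ⊗ 𝟙` is a ⋆-isomorphism onto the
C⋆-subalgebra `𝔄_{Λ₁} ⊗ 𝟙_{Λ₂}`, Bratteli–Robinson I Example 2.6.12 / II §6.2.1; on the
Guichardet space `A ⊗ 𝟙` is `π_Λ(A) = localRepCLM Λ A`): `π_Λ(A) ξ` is the finite combination
`∑_{τ,τ'} A τ' τ • (e_{τ' τ} ⊗ 𝟙) ξ` of the vectors `spliceVec Λ τ τ' ξ` (`localRepVec_eq_sum` of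
the companion file), and the matrix units `e_{τ' τ} ⊗ 𝟙`, `e_{τ τ'} ⊗ 𝟙` are mutually adjoint:
the `ℓ²` sums `⟪(e_{τ τ'} ⊗ 𝟙) ψ, φ⟫` and `⟪ψ, (e_{τ' τ} ⊗ 𝟙) φ⟫` agree term by term after the
block permutation `σ ↦ σ.splice Λ (swap τ τ' (σ|_Λ))` of the configurations
(`inner_spliceVec_comm`). Hence `⟪π_Λ(Aᴴ) ψ, φ⟫ = ⟪ψ, π_Λ(A) φ⟫` (`inner_localRepCLM_star_left`)
and `π_Λ(Aᴴ) = π_Λ(A)⋆` since `⋆ = adjoint` on `B(𝓗)`.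

Isotony (the same Example 2.6.12: for disjoint `Λ₁, Λ₂`, `𝓗_{Λ₁ ∪ Λ₂} = 𝓗_{Λ₁} ⊗ 𝓗_{Λ₂}` and
`𝔄_{Λ₁}` is identified with `𝔄_{Λ₁} ⊗ 𝟙_{Λ₂} ⊆ 𝔄_{Λ₁ ∪ Λ₂}`, so that `{𝔄_Λ}` is an increasing
family of matrix algebras; Bratteli–Robinson II §6.2.1 for spin systems): entrywise
`(π_{Λ'}(A ⊗ 𝟙) ψ)(σ) = ∑_{τ'} (A ⊗ 𝟙)(σ|_{Λ'}, τ') ψ(σ ∨_{Λ'} τ')`; the entry of `A ⊗ 𝟙_{Λ'∖Λ}`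
vanishes unless `τ'` agrees with `σ` on `Λ' ∖ Λ`, the surviving labels are the extensions `e τ`
of the blocks `τ : Λ → Fin q` by `σ|_{Λ'∖Λ}`, on which the entry is `A(σ|_Λ, τ)` and
`σ ∨_{Λ'} e τ = σ ∨_Λ τ`: a reindexing of a finite sum along the injection `e`.

## Sources

* O. Bratteli, D. W. Robinson, *Operator Algebras and Quantum Statistical Mechanics I* (2nd ed.,
  Springer 1987), §2.2.2: Proposition 2.2.7 (spectral permanence), Definition 2.2.8 (positive
  elements), Theorem 2.2.10 (square roots; the fact's docstring calls it "Prop. 2.2.10"),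
  Theorem 2.2.12 (`A ≥ 0 ⇔ A = B⋆B`); §2.6.1, Example 2.6.12 (UHF algebras:
  `𝔄_{Λ₁} ≅ 𝔄_{Λ₁} ⊗ 𝟙_{Λ₂} ⊆ 𝔄_{Λ₁ ∪ Λ₂}`).
* O. Bratteli, D. W. Robinson, *Operator Algebras and Quantum Statistical Mechanics II* (2nd
  ed., Springer 1997), §6.2.1 (quantum spin systems: `𝔄_Λ = 𝓛(𝓗_Λ)`, `𝓗_Λ = ⊗_{x∈Λ} ℂ^q`,
  isotony `𝔄_{Λ₁} ⊆ 𝔄_{Λ₂}` for `Λ₁ ⊆ Λ₂` via `A ↦ A ⊗ 𝟙`).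

## Mathlib search and design notes

* Used from Mathlib: the real continuous functional calculus of a C⋆-algebra
  (`IsSelfAdjoint.instIsometricContinuousFunctionalCalculus`, `cfc`, `cfc_mul`, `cfc_id'`,
  `cfc_congr`, `cfc_predicate`), `cfc_mem` (the functional calculus of `a` stays in every closed
  ⋆-subalgebra containing `a` — Theorem 2.2.10's membership clause), `spectrum_nonneg_of_nonneg`
  (`NonnegSpectrumClass ℝ B(𝓗)`), the Loewner `StarOrderedRing` on `B(𝓗)`
  (`ContinuousLinearMap.instStarOrderedRing`, `star_mul_self_nonneg`) and the constructor
  `StarOrderedRing.of_nonneg_iff'`.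
* Instance path: Mathlib registers the real functional calculus of `B(𝓗)` for the `ℝ`-algebra
  structure restricted from `ℂ` (`Algebra.complexToReal`, `StarModule.complexToReal`); on
  `B(ℓ²)` instance search instead finds the pointwise real structure coming from the real
  `ℓ²`-module (`ContinuousLinearMap.algebra`), which is definitionally equal but not reducibly so.
  The proof therefore re-registers the two instances locally with `haveI`; no global instance is
  declared.
* The fact stays a `def … : Prop`; users feed `starOrderedRing_quasiLocalAlg_holds d q hstar` to
  the hypotheses `hsor : starOrderedRing_quasiLocalAlg d q hstar` of
  `Literature.Analysis.FunctionSpaces.uhfQuasiLocalAlgebra` / `nonempty_quasiLocalAlgebra_of_uhf`.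
* Likewise `localRep_injective` stays a `def … : Prop`; users feed `localRep_injective_holds` to
  the hypotheses `hinj : localRep_injective` (`uhfQuasiLocalAlgebra`, `localRepCod_injective`,
  `nonempty_quasiLocalAlgebra_of_uhf'`); `nonempty_quasiLocalAlgebra_of_uhf''` has both `hsor`
  and `hinj` supplied. The injectivity proof uses only the in-file coordinate formula
  `localRepCLM_apply`, the splice algebra `FinSuppConfig.restrict_splice`/`splice_splice`, and
  Mathlib's `lp.single_apply`, `Pi.single_eq_same`/`Pi.single_eq_of_ne`, `Finset.sum_eq_single`.
* Likewise `localRep_map_star'` stays a `def … : Prop`; users feed `localRep_map_star'_holds` for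
  the standing hypothesis `hstar` (`localRep`, `quasiLocalAlg`, …);
  `nonempty_quasiLocalAlgebra_of_uhf'''` has `hstar`, `hsor` and `hinj` supplied. The proof uses
  Mathlib's `ContinuousLinearMap.star_eq_adjoint`, `ContinuousLinearMap.eq_adjoint_iff`,
  `lp.inner_eq_tsum`, `Equiv.tsum_eq` (reindexing an unconditional `tsum` along a bijection, so no
  summability bookkeeping), `sum_inner`/`inner_sum`/`inner_smul_left`/`inner_smul_right`, and the
  companion file's `localRepVec_eq_sum`, `spliceVec_apply` and splice algebra. No definition is
  added (the block permutation is a local `Equiv` inside the proof of `inner_spliceVec_comm`).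
* Likewise `localRep_compatible` stays a `def … : Prop`; users feed `localRep_compatible_holds` to
  the hypotheses `hcompat : localRep_compatible` (`coe_localAlgebra`,
  `dense_iUnion_range_localRepCod`, `uhfQuasiLocalAlgebra`,
  `nonempty_quasiLocalAlgebra_of_uhf'''`). The isotony proof uses only `localRepCLM_apply`, the
  definition of `embedOp`, `FinSuppConfig.splice_apply`/`FinSuppConfig.ext`, and Mathlib's
  `Fintype.sum_of_injective`.
-/

noncomputable section

open scoped ComplexOrder

namespace Literature.Analysis.FunctionSpaces

section QLattice

variable (d q : ℕ) [NeZero q]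
variable (hstar : localRep_map_star' (d := d) (q := q))

/-- **The inherited Loewner order on `𝔄` is its C⋆-order** (discharge of the named fact
`starOrderedRing_quasiLocalAlg`). For `S, T ∈ 𝔄` one has `S ≤ T` in `B(𝓗)` iff `T = S + R⋆R`
for some `R ∈ 𝔄`: if `P = T - S ≥ 0` in `B(𝓗)`, its positive square root `R = √P`
(continuous functional calculus, `cfc Real.sqrt`) is selfadjoint with `R⋆R = R² = P`
(`σ(P) ⊆ [0, ∞)`), and `R` lies in the C⋆-subalgebra generated by `P`, hence in the norm-closed
⋆-subalgebra `𝔄 ∋ P` (Mathlib `cfc_mem`) — Bratteli–Robinson I, Theorem 2.2.10 (a positive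
element of a C⋆-algebra has a unique positive square root, lying in the abelian C⋆-subalgebra it
generates; this is the result the fact's docstring cites as "Prop. 2.2.10"), with
Definition 2.2.8 (positivity via the spectrum), Proposition 2.2.7 (spectral permanence
`σ_𝔄(A) = σ_𝔅(A)` for C⋆-subalgebras `𝔅 ⊆ 𝔄`) and Theorem 2.2.12 (`A ≥ 0 ⇔ A = B⋆B`);
conversely every `R⋆R` is Loewner-positive.
[cite: BratteliRobinsonI1987, Thm. 2.2.10, Prop. 2.2.7, Thm. 2.2.12] -/
theorem starOrderedRing_quasiLocalAlg_holds : starOrderedRing_quasiLocalAlg d q hstar := by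
  unfold starOrderedRing_quasiLocalAlg
  -- re-register Mathlib's real functional calculus / real star-module structure of `B(𝓗)` for
  -- the `ℝ`-algebra instance found on `B(ℓ²)` (see the module docstring)
  haveI hcfc : ContinuousFunctionalCalculus ℝ (GuichardetSpace d q →L[ℂ] GuichardetSpace d q)
      IsSelfAdjoint :=
    (inferInstance : @ContinuousFunctionalCalculus ℝ
      (GuichardetSpace d q →L[ℂ] GuichardetSpace d q) IsSelfAdjoint _ _ _ _ _ _ _ _
        Algebra.complexToReal)
  haveI hsm : StarModule ℝ (GuichardetSpace d q →L[ℂ] GuichardetSpace d q) :=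
    StarModule.complexToReal
  -- the inherited order is the Loewner order of the underlying operators
  have hle : ∀ S T : ↥(quasiLocalAlg d q hstar),
      S ≤ T ↔ (S : GuichardetSpace d q →L[ℂ] GuichardetSpace d q) ≤ T := fun S T => Iff.rfl
  refine StarOrderedRing.of_nonneg_iff' (@fun S T h R => ?_) fun T => ⟨fun hT => ?_, ?_⟩
  · -- translation invariance, inherited from `B(𝓗)`
    rw [hle] at h ⊢
    simpa only [AddMemClass.coe_add] using add_le_add le_rfl h
  · -- `0 ≤ T` in `B(𝓗)` ⟹ `T = R⋆R` with `R = √T ∈ 𝔄`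
    have hT' : (0 : GuichardetSpace d q →L[ℂ] GuichardetSpace d q) ≤ T := by
      simpa only [ZeroMemClass.coe_zero] using (hle 0 T).mp hT
    set P : GuichardetSpace d q →L[ℂ] GuichardetSpace d q := ↑T with hP
    have hR : IsSelfAdjoint (cfc Real.sqrt P) := cfc_predicate Real.sqrt P
    have hRR : star (cfc Real.sqrt P) * cfc Real.sqrt P = P := by
      rw [hR.star_eq, ← cfc_mul Real.sqrt Real.sqrt P]
      conv_rhs => rw [← cfc_id' ℝ P hT'.isSelfAdjoint]
      exact cfc_congr fun t ht => Real.mul_self_sqrt (spectrum_nonneg_of_nonneg hT' ht)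
    refine ⟨⟨cfc Real.sqrt P, cfc_mem Real.sqrt T.2⟩, Subtype.ext ?_⟩
    simpa only [MulMemClass.coe_mul, StarMemClass.coe_star] using hRR.symm
  · -- `R⋆R ≥ 0` in `B(𝓗)`
    rintro ⟨R, rfl⟩
    rw [hle]
    simpa only [ZeroMemClass.coe_zero, MulMemClass.coe_mul, StarMemClass.coe_star] using
      star_mul_self_nonneg (R : GuichardetSpace d q →L[ℂ] GuichardetSpace d q)

/-- The concrete quasi-local algebra on the Guichardet space as a `QuasiLocalAlgebra d q`, with the
order hypothesis `hsor` of `uhfQuasiLocalAlgebra` now supplied by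
`starOrderedRing_quasiLocalAlg_holds` (the remaining analytic facts stay hypotheses).
Bratteli–Robinson I §2.6.1, Example 2.6.12; Bratteli–Robinson II §6.2.1. [folklore] -/
theorem nonempty_quasiLocalAlgebra_of_uhf' (hinj : localRep_injective (d := d) (q := q))
    (hcompat : localRep_compatible (d := d) (q := q))
    (hcomm : localRep_commute_of_disjoint (d := d) (q := q))
    (hshift : shift_mem_quasiLocalAlg hstar) (hshiftι : shiftAut_localRepCod hstar hshift) :
    Nonempty (Literature.MathematicalPhysics.QuantumLattice.QuasiLocalAlgebra d q) :=
  nonempty_quasiLocalAlgebra_of_uhf d q hstar hinj hcompat hcomm hshift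
    (starOrderedRing_quasiLocalAlg_holds d q hstar) hshiftι

/-! ### Discharge of `localRep_injective` -/

variable {d q}

/-- Splicing into a fixed configuration is injective in the inserted block (restrict back to
`Λ`, `FinSuppConfig.restrict_splice`). Bratteli–Robinson II §6.2.1. [folklore] -/
theorem FinSuppConfig.splice_right_injective (Λ : Finset (Literature.Probability.LatticeModels.Site d))
    (σ : FinSuppConfig d q) : Function.Injective fun τ : ↥Λ → Fin q => σ.splice Λ τ :=
  fun τ τ' h => by
  simpa only [FinSuppConfig.restrict_splice] using congrArg (FinSuppConfig.restrict Λ) h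

/-- **Matrix coefficients from product basis vectors**: `π_Λ(A)` applied to the basis vector
`δ_ρ`, `ρ = (τ₀ inside Λ, 0 outside)`, has coordinate `A τ' τ₀` at `(τ' inside Λ, 0 outside)`,
i.e. `⟪e_{τ'} ⊗ Ω_{Λᶜ}, (A ⊗ 𝟙) (e_{τ₀} ⊗ Ω_{Λᶜ})⟫ = A τ' τ₀`. Bratteli–Robinson I
Example 2.6.12 (`𝔄_{Λ₁} ≅ 𝔄_{Λ₁} ⊗ 𝟙_{Λ₂}`); Bratteli–Robinson II §6.2.1. [cite: BratteliRobinsonII1997, §6.2.1] -/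
theorem localRepCLM_single_splice (Λ : Finset (Literature.Probability.LatticeModels.Site d)) (A : Literature.MathematicalPhysics.QuantumLattice.Op ↥Λ q)
    (τ₀ τ' : ↥Λ → Fin q) :
    localRepCLM Λ A (lp.single 2 ((0 : FinSuppConfig d q).splice Λ τ₀) (1 : ℂ))
      ((0 : FinSuppConfig d q).splice Λ τ') = A τ' τ₀ := by
  rw [localRepCLM_apply]
  simp only [FinSuppConfig.restrict_splice, FinSuppConfig.splice_splice, lp.single_apply]
  rw [Finset.sum_eq_single τ₀]
  · rw [Pi.single_eq_same, mul_one]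
  · intro τ _ hτ
    rw [Pi.single_eq_of_ne ((FinSuppConfig.splice_right_injective Λ 0).ne hτ), mul_zero]
  · intro h
    exact absurd (Finset.mem_univ τ₀) h

/-- **`π_Λ` is injective** (discharge of the named fact `localRep_injective`): the matrix
coefficients of `A` are recovered from `π_Λ(A)` on product basis vectors
(`localRepCLM_single_splice`), so `π_Λ(A) = π_Λ(B)` forces `A = B`. This is the printed assertion
that `A ↦ A ⊗ 𝟙_{Λ₂}` identifies `𝔄_{Λ₁} = 𝓛(𝓗_{Λ₁})` isomorphically with the C⋆-subalgebra
`𝔄_{Λ₁} ⊗ 𝟙_{Λ₂}` of `𝔄_{Λ₁ ∪ Λ₂}`, Bratteli–Robinson I Example 2.6.12 (UHF algebras), specialised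
in Bratteli–Robinson II §6.2.1 to quantum spin systems on `ℤ^ν`; here for the Guichardet-space
representation `π_Λ = localRepCLM Λ`. [cite: BratteliRobinsonII1997, §6.2.1] -/
theorem localRep_injective_holds : localRep_injective (d := d) (q := q) := by
  intro Λ A B hAB
  ext τ' τ₀
  rw [← localRepCLM_single_splice Λ A τ₀ τ', ← localRepCLM_single_splice Λ B τ₀ τ', hAB]

variable (d q) in
/-- The concrete quasi-local algebra on the Guichardet space as a `QuasiLocalAlgebra d q`, with the
order hypothesis `hsor` and the injectivity hypothesis `hinj` of `uhfQuasiLocalAlgebra` supplied by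
`starOrderedRing_quasiLocalAlg_holds` and `localRep_injective_holds` (the remaining analytic facts
`hstar`, `hcompat`, `hcomm`, `hshift`, `hshiftι` stay hypotheses). Bratteli–Robinson I §2.6.1,
Example 2.6.12; Bratteli–Robinson II §6.2.1. [folklore] -/
theorem nonempty_quasiLocalAlgebra_of_uhf''
    (hcompat : localRep_compatible (d := d) (q := q))
    (hcomm : localRep_commute_of_disjoint (d := d) (q := q))
    (hshift : shift_mem_quasiLocalAlg hstar) (hshiftι : shiftAut_localRepCod hstar hshift) :
    Nonempty (Literature.MathematicalPhysics.QuantumLattice.QuasiLocalAlgebra d q) :=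
  nonempty_quasiLocalAlgebra_of_uhf' d q hstar localRep_injective_holds hcompat hcomm hshift hshiftι

/-! ### Discharge of `localRep_map_star'` -/

open scoped InnerProductSpace

/-- **The matrix units `e_{τ' τ} ⊗ 𝟙` and `e_{τ τ'} ⊗ 𝟙` are mutually adjoint** on the Guichardet
space: `⟪spliceVec Λ τ' τ ψ, φ⟫ = ⟪ψ, spliceVec Λ τ τ' φ⟫`, where
`spliceVec Λ τ τ' ξ = (e_{τ' τ} ⊗ 𝟙_{Λᶜ}) ξ` (`σ ↦ [σ|_Λ = τ'] ξ(σ with τ spliced into Λ)`).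
Both sides are `ℓ²` sums over configurations (`lp.inner_eq_tsum`), and they agree term by term
after the block permutation `σ ↦ σ.splice Λ (swap τ τ' (σ|_Λ))` of `FinSuppConfig d q`
(`Equiv.tsum_eq`; no summability is needed). Bratteli–Robinson I Example 2.6.12
(`𝔄_{Λ₁} ≅ 𝔄_{Λ₁} ⊗ 𝟙_{Λ₂}` as a C⋆-subalgebra); Bratteli–Robinson II §6.2.1. [cite: BratteliRobinsonII1997, §6.2.1] -/
theorem inner_spliceVec_comm (Λ : Finset (Literature.Probability.LatticeModels.Site d)) (τ τ' : ↥Λ → Fin q)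
    (ψ φ : GuichardetSpace d q) :
    ⟪spliceVec Λ τ' τ ψ, φ⟫_ℂ = ⟪ψ, spliceVec Λ τ τ' φ⟫_ℂ := by
  -- the block permutation of configurations exchanging the blocks `τ`, `τ'` inside `Λ`
  let e : FinSuppConfig d q ≃ FinSuppConfig d q :=
    { toFun := fun σ => σ.splice Λ (Equiv.swap τ τ' (σ.restrict Λ))
      invFun := fun σ => σ.splice Λ (Equiv.swap τ τ' (σ.restrict Λ))
      left_inv := fun σ => by simp
      right_inv := fun σ => by simp }
  rw [lp.inner_eq_tsum, lp.inner_eq_tsum, ← Equiv.tsum_eq e fun σ => ⟪ψ σ, spliceVec Λ τ τ' φ σ⟫_ℂ]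
  refine tsum_congr fun σ => ?_
  simp only [e, Equiv.coe_fn_mk, spliceVec_apply, FinSuppConfig.restrict_splice,
    FinSuppConfig.splice_splice]
  by_cases hσ : σ.restrict Λ = τ
  · rw [if_pos hσ, hσ, Equiv.swap_apply_left, if_pos rfl, ← hσ, FinSuppConfig.splice_restrict]
  · have hne : Equiv.swap τ τ' (σ.restrict Λ) ≠ τ' := by
      intro h
      apply hσ
      have := congrArg (Equiv.swap τ τ') h
      rwa [Equiv.swap_apply_self, Equiv.swap_apply_right] at this
    rw [if_neg hσ, if_neg hne, inner_zero_left, inner_zero_right]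

/-- **`π_Λ(Aᴴ)` is the formal adjoint of `π_Λ(A)`**: `⟪π_Λ(Aᴴ) ψ, φ⟫ = ⟪ψ, π_Λ(A) φ⟫` for all
`ψ, φ ∈ 𝓗`. Expand `π_Λ(B) ξ = ∑_{τ,τ'} B τ' τ • (e_{τ' τ} ⊗ 𝟙) ξ` (`localRepVec_eq_sum`), pull the
finite sums and the scalars out of the inner product, exchange the two finite sums on one side,
and match the terms with `inner_spliceVec_comm`. Bratteli–Robinson II §6.2.1; Bratteli–Robinson I
Example 2.6.12. [cite: BratteliRobinsonII1997, §6.2.1] -/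
theorem inner_localRepCLM_star_left (Λ : Finset (Literature.Probability.LatticeModels.Site d)) (A : Literature.MathematicalPhysics.QuantumLattice.Op ↥Λ q)
    (ψ φ : GuichardetSpace d q) :
    ⟪localRepCLM Λ (star A) ψ, φ⟫_ℂ = ⟪ψ, localRepCLM Λ A φ⟫_ℂ := by
  change ⟪localRepVec Λ (star A) ψ, φ⟫_ℂ = ⟪ψ, localRepVec Λ A φ⟫_ℂ
  rw [localRepVec_eq_sum, localRepVec_eq_sum, sum_inner, inner_sum]
  simp_rw [sum_inner, inner_sum]
  rw [Finset.sum_comm]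
  refine Finset.sum_congr rfl fun τ _ => Finset.sum_congr rfl fun τ' _ => ?_
  rw [inner_smul_left, inner_smul_right, Matrix.star_apply, starRingEnd_apply, star_star,
    inner_spliceVec_comm]

/-- **`π_Λ` preserves adjoints** (discharge of the named fact `localRep_map_star'`):
`π_Λ(Aᴴ) = π_Λ(A)⋆` in `B(𝓗)` for every finite `Λ ⊆ ℤ^d` and `A ∈ 𝔄_Λ = Op ↥Λ q`, i.e.
`A ↦ A ⊗ 𝟙_{Λᶜ}` is a ⋆-map on the Guichardet space (`⋆ = adjoint` on `B(𝓗)`,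
`ContinuousLinearMap.star_eq_adjoint`/`eq_adjoint_iff`, and `inner_localRepCLM_star_left`).
This is the printed assertion that `A ↦ A ⊗ 𝟙_{Λ₂}` identifies `𝔄_{Λ₁} = ℒ(𝓗_{Λ₁})` with the
C⋆-subalgebra `𝔄_{Λ₁} ⊗ 𝟙_{Λ₂}` of `𝔄_{Λ₁ ∪ Λ₂}` (Bratteli–Robinson I Example 2.6.12, UHF
algebras), used for quantum spin systems on `ℤ^ν` in Bratteli–Robinson II §6.2.1; here for the
Guichardet-space representation `π_Λ = localRepCLM Λ`. [cite: BratteliRobinsonII1997, §6.2.1] -/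
theorem localRep_map_star'_holds : localRep_map_star' (d := d) (q := q) := by
  intro Λ A
  rw [ContinuousLinearMap.star_eq_adjoint, ContinuousLinearMap.eq_adjoint_iff]
  exact inner_localRepCLM_star_left Λ A

variable (d q) in
/-- The concrete quasi-local algebra on the Guichardet space as a `QuasiLocalAlgebra d q`, with the
⋆-preservation hypothesis `hstar`, the order hypothesis `hsor` and the injectivity hypothesis
`hinj` of `uhfQuasiLocalAlgebra` supplied by `localRep_map_star'_holds`,
`starOrderedRing_quasiLocalAlg_holds` and `localRep_injective_holds` (the remaining analytic facts
`hcompat`, `hcomm`, `hshift`, `hshiftι` stay hypotheses). Bratteli–Robinson I §2.6.1,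
Example 2.6.12; Bratteli–Robinson II §6.2.1. [folklore] -/
theorem nonempty_quasiLocalAlgebra_of_uhf'''
    (hcompat : localRep_compatible (d := d) (q := q))
    (hcomm : localRep_commute_of_disjoint (d := d) (q := q))
    (hshift : shift_mem_quasiLocalAlg (localRep_map_star'_holds (d := d) (q := q)))
    (hshiftι : shiftAut_localRepCod localRep_map_star'_holds hshift) :
    Nonempty (Literature.MathematicalPhysics.QuantumLattice.QuasiLocalAlgebra d q) :=
  nonempty_quasiLocalAlgebra_of_uhf'' d q localRep_map_star'_holds hcompat hcomm hshift hshiftι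

/-! ### Discharge of the isotony fact `localRep_compatible` -/

/-- **Isotony/compatibility holds**: `π_{Λ'} (A ⊗ 𝟙_{Λ'∖Λ}) = π_Λ (A)` for `Λ ⊆ Λ'`, discharging
the named fact `localRep_compatible`. Entrywise,
`(π_{Λ'}(A ⊗ 𝟙) ψ)(σ) = ∑_{τ'} (A ⊗ 𝟙)(σ|_{Λ'}, τ') ψ(σ ∨_{Λ'} τ')`, and the matrix entry of
`A ⊗ 𝟙_{Λ'∖Λ}` vanishes unless `τ'` agrees with `σ` on `Λ' ∖ Λ`; the surviving labels `τ'` are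
exactly the extensions `e τ` of the blocks `τ : Λ → Fin q` by `σ|_{Λ'∖Λ}` (the product basis of
`𝓗_{Λ'} = 𝓗_Λ ⊗ 𝓗_{Λ'∖Λ}` over the fixed label `σ|_{Λ'∖Λ}`), on which the entry is `A(σ|_Λ, τ)`
and `σ ∨_{Λ'} e τ = σ ∨_Λ τ` — a reindexing of a finite sum along the injection `e`
(`Fintype.sum_of_injective`). This is the identification `𝔄_{Λ₁} ≅ 𝔄_{Λ₁} ⊗ 𝟙_{Λ₂} ⊆ 𝔄_{Λ₁ ∪ Λ₂}`
making `{𝔄_Λ}_Λ` an increasing family of matrix algebras, Bratteli–Robinson I Example 2.6.12, in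
the spatial (Guichardet-space) realisation of the quantum spin system, Bratteli–Robinson II
§6.2.1. [cite: BratteliRobinsonII1997, §6.2.1] -/
theorem localRep_compatible_holds : localRep_compatible (d := d) (q := q) := by
  intro Λ Λ' h A
  ext ψ σ
  simp only [localRepCLM_apply]
  -- the extension `e τ` of a block `τ : Λ → Fin q` to `Λ'` by the values of `σ` off `Λ`
  obtain ⟨e, he_on, he_off⟩ : ∃ e : (↥Λ → Fin q) → (↥Λ' → Fin q),
      (∀ (τ : ↥Λ → Fin q) (y : ↥Λ') (hy : (y : Literature.Probability.LatticeModels.Site d) ∈ Λ), e τ y = τ ⟨y, hy⟩) ∧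
      (∀ (τ : ↥Λ → Fin q) (y : ↥Λ'), (y : Literature.Probability.LatticeModels.Site d) ∉ Λ → e τ y = σ.1 y) :=
    ⟨fun τ y => if hy : (y : Literature.Probability.LatticeModels.Site d) ∈ Λ then τ ⟨y, hy⟩ else σ.1 y,
      fun τ y hy => dif_pos hy, fun τ y hy => dif_neg hy⟩
  have he_res : ∀ τ : ↥Λ → Fin q, (fun x : ↥Λ => e τ ⟨x, h x.2⟩) = τ :=
    fun τ => funext fun x => he_on τ ⟨x, h x.2⟩ x.2
  have he_inj : Function.Injective e := fun τ₁ τ₂ hτ => by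
    rw [← he_res τ₁, ← he_res τ₂]
    exact funext fun x => by rw [hτ]
  have he_splice : ∀ τ : ↥Λ → Fin q, σ.splice Λ' (e τ) = σ.splice Λ τ := fun τ => by
    refine FinSuppConfig.ext fun x => ?_
    rw [FinSuppConfig.splice_apply, FinSuppConfig.splice_apply]
    by_cases hx : x ∈ Λ
    · rw [dif_pos (h hx), dif_pos hx]
      exact he_on τ ⟨x, h hx⟩ hx
    · rw [dif_neg hx]
      by_cases hx' : x ∈ Λ'
      · rw [dif_pos hx']
        exact he_off τ ⟨x, hx'⟩ hx
      · rw [dif_neg hx']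
  symm
  refine Fintype.sum_of_injective e he_inj _ _ (fun τ' hτ' => ?_) (fun τ => ?_)
  · -- off the range of `e` the matrix entry of `A ⊗ 𝟙_{Λ'∖Λ}` vanishes
    simp only [Literature.MathematicalPhysics.QuantumLattice.embedOp, Matrix.of_apply]
    split_ifs with hc
    · refine (hτ' ⟨fun x => τ' ⟨x, h x.2⟩, funext fun y => ?_⟩).elim
      by_cases hy : (y : Literature.Probability.LatticeModels.Site d) ∈ Λ
      · exact (he_on _ y hy).trans rfl
      · exact (he_off _ y hy).trans (hc y hy)
    · exact zero_mul _
  · -- on the range of `e` the entry is `A (σ|_Λ) τ` and the spliced configurations agree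
    rw [he_splice τ]
    simp only [Literature.MathematicalPhysics.QuantumLattice.embedOp, Matrix.of_apply]
    split_ifs with hc
    · rw [he_res τ]
      rfl
    · exact absurd (fun y hy => (he_off τ y hy).symm) hc

variable (d q) in
/-- The concrete quasi-local algebra on the Guichardet space as a `QuasiLocalAlgebra d q`, with the
⋆-preservation hypothesis `hstar`, the order hypothesis `hsor`, the injectivity hypothesis `hinj`
and the isotony hypothesis `hcompat` of `uhfQuasiLocalAlgebra` supplied by
`localRep_map_star'_holds`, `starOrderedRing_quasiLocalAlg_holds`, `localRep_injective_holds` and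
`localRep_compatible_holds` (the remaining analytic facts — locality `hcomm` and the shift facts
`hshift`, `hshiftι` — stay hypotheses). Bratteli–Robinson I §2.6.1, Example 2.6.12;
Bratteli–Robinson II §6.2.1. [folklore] -/
theorem nonempty_quasiLocalAlgebra_of_locality_shift
    (hcomm : localRep_commute_of_disjoint (d := d) (q := q))
    (hshift : shift_mem_quasiLocalAlg (localRep_map_star'_holds (d := d) (q := q)))
    (hshiftι : shiftAut_localRepCod localRep_map_star'_holds hshift) :
    Nonempty (Literature.MathematicalPhysics.QuantumLattice.QuasiLocalAlgebra d q) :=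
  nonempty_quasiLocalAlgebra_of_uhf''' d q localRep_compatible_holds hcomm hshift hshiftι

end QLattice

end Literature.Analysis.FunctionSpaces
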